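import Summits.QuantumFields.BalabanUV.Beta.D1BFx.SplitRecut

/-!
# `BalabanUV.Beta.D1BFx.SplitInstanceS` — road «BF-x» for binder row D1, slot (SPLIT)∕(REST), variant «ENDₛ» (RULINGS ρ-g11-9 ∕ ρ-g11-11, binder GO
# R-D1-g31-2): THE RE-CUT REST WORD TABLE WITH THE GHOST WORDS AT A SECOND PROFILE (`restKS g g'`), THE MAIN TERM WITH A RESCALED GHOST PROFILE
# (`main_table_eq_bfKernelS`: ghost frozen leg `s•g`, weight tie `ω_gh·(s·cK)² = −2·ω_gl·cE²`), AND THE (SPLIT) IDENTITY AT A BASE SITE FOR THEM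
# (`split_at_basePoint_recutS`) — `s = 1` is the table of record (`restKS g g = restK'`), `s = n⁻²` is «END-ii» (`HOME/b2b-balaban-beta-d1-p2/END-ii-SPEC.md` v1.1)

HONEST DEPENDENCY (page 1, mandatory): continuum YM on T⁴ ⇐ BetaPertH ∧ nine spine estimates (0/9 proved); BetaPertH ⇐ (D1) ∧ (D4) ∧
CAP+tail; G-an2-4 gates asym, D1 and NE2/3/4.  HONEST FRAMING (cell contract, verbatim): «discharging `BetaPertH` makes Bałaban's UV
stability UNCONDITIONAL — a real constructive-QFT result; it is NOT the continuum limit and NOT the Clay problem.»  THIS MODULE DISCHARGES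
NOTHING of the wall: ONE definition with a body ([our object] `restKS`, the re-cut TERM LIST `SplitRecut.restK'` as data with the ghost tadpole and
ghost bubble words read at a SECOND frozen profile `g'`; same index `SplitInstance.RestIdx`, same signature plus one profile argument) and [folklore]
`ring` ∕ finite-sum bookkeeping BY NAME over `MainTable` (parts 4a∕4b∕5a∕5e: `bubble_vecStn_frozen`, `bubble_ghCur_ghCur_frozen`, `stK_of_bfKernel`), leaf-03-g3's
A0-FINE expansions (`FineHessianLegGrades.Kf_gluon_eq_gradedTerms`, `FineHessianGhostGrades.Kf_ghost_eq_gradedTerms` — the latter AT THE PROFILE `s•g`) and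
`SectorRecut.gradedWordSum_eq_gradedWordSum'`.  No `Prop` is minted, nothing is cited, no hypothesis is a printed statement, 0 sorry.  0 wall binders
instantiated; NOT the (REST) bounds, NOT (K), NOT D1, NOT `BetaPertH`, NOT continuum, NOT Clay.

ABSOLUTE RULE (cell charter, verbatim): «No internally-minted statement may enter as a cited fact. Every hypothesis is either kernel-proved in
this package or a verbatim quotation of a PUBLISHED theorem with page reference. The manuscript(s) under audit are NOT citable for their own
disputed steps — they are the thing under adjudication; programme-internal (2001/route/tribunal) claims are never citable.»

WHY (owner d1-p2 gen 11 RULING ρ-g11-9 «GHOST UNITS», an3-g63's audit adopted; `END-ii-SPEC.md` v1.1 §§1–3; binder an2-g31 R-D1-g31-2 «Q-END-ii: GO, (a) now»).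
The END of record ties the ghost and gluon loop weights by `hω : ω_gh·cK² = −2·ω_gl·cE²` (`RoadEndBFxRecutRay`); against the TYPED legs (`Ggh n a` = inverse of
`n²(−Δ) + a·n⁻⁴·1_blk`, so `n²·Ggh ≈ gFree`, while `Ga ≈ G₀`) the prefactor-level transcription of R-4(v) «ghost −2 : gluon +1» is `ω_gh·(n⁻²·cK)² = −2·ω_gl·cE²` —
`hω` is short by `n⁴`, and the END's ghost-rest slots are then unsatisfiable by Bałaban's kernels (the END stays kernel-true; reading (i)).  The consistent
reading (ii) keeps EVERY gluon-side object and the value of the MAIN term (`stK μ ν N g`, hence the `11N²∕3` coefficient, the shell telescoping, the (K)-slot form)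
and changes exactly two things: the weight tie, and the frozen profile at which the GHOST graded words are read (`n⁻²·g` instead of `g`: the regraded split
`Ggh = n⁻²·fL + (Ggh − n⁻²·fL)` has the small grade-1 piece).  THIS FILE types both changes ONCE, for an arbitrary scalar `s` («ENDₛ»): because an3's cell form is
QUADRATIC in the profile (`cellForm_smul`), the ghost frozen⊗frozen bubble over `s•g` is `s²·(2·cellForm g)`, and under `ω_gh·(s·cK)² = −2·ω_gl·cE²` with the
normalisation `ω_gl·cE² = 2N²·lam` the weighted MAIN combination is `lam·bfKernel g N` EXACTLY AS OF RECORD (`main_table_eq_bfKernelS`); the (SPLIT) identity follows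
with the ghost expansion taken at `s•g` (`split_at_basePoint_recutS`).  `s = 1`: the identity of record (`restKS g g = restK'`, `restKS_self`); `s = n⁻²`: END-ii.
WHAT IT DOES NOT DO: bound any REST word, fix `ω_gl, ω_gh, s` or the normalisation (slot (K) ∕ CHECK-N0), choose `g` — all displayed as parameters ∕ hypotheses;
the END-level twins of the chain `AssemblyEnd* → RoadEndBFx* → RoadEndBFxWired` over `restKS` are SEPARATE files (END-ii-SPEC §3 (b)).

CONTENT.
* §1 [folklore] `cellForm_smul` (`cellForm (s•g) = s²·cellForm g`); **`main_tableS`** (MAIN in closed form, gluon frozen leg over `g`, ghost frozen leg over `g'`);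
  **`main_table_eq_bfKernelS`** (`g' = s•g`, tie `ω_gh·(s·cK)² = −2·ω_gl·cE²`, `ω_gl·cE² = 2N²·lam` ⇒ MAIN `= lam·bfKernel g N u_μ u_ν v`).
* §2 [our object] **`restKS`** (two profiles); unfoldings `restKS_tad`∕`_bub`∕`_gtad`∕`_gbub`∕`_corner`∕`_crossE`; the per-range transfers `restKS_tad_eq`∕`_bub_eq`∕
  `_corner_eq`∕`_crossE_eq` (= `restK'` at `g`, rfl) and `restKS_gtad_eq`∕`_gbub_eq` (= `restK'` at `g'`, rfl); `restKS_self` (`restKS g g = restK' g`); `sum_restKS`.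
* §3 [folklore] **`split_at_basePoint_recutS`** — `SplitRecut.split_at_basePoint_recut` with `hω ↦ hωs : ω_gh·(s·cK)² = −2·(ω_gl·cE²)` and
  `restK' g ↦ restKS g (fun v => s * g v)`; left side and every other hypothesis byte-identical.
Unit `b2b-balaban-beta-d1-p2` (road owner, gen 12); `LEAVES-BFx.md` rows (SPLIT)∕(REST) («ENDₛ»), `END-ii-SPEC.md` v1.1 §3 (a).
-/

noncomputable section

namespace Summit.QuantumFields.BalabanUV.Beta.D1BFx.SplitInstanceS

open Finset
open scoped BigOperators
open Literature.MathematicalPhysics.QuantumFieldTheory.Balaban1983to89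
open Literature.MathematicalPhysics.QuantumFieldTheory.Balaban1983to89.Beta
open B12Sec2to5 (l1)
open ExpKernelCalculus (Site MKer bubble)
open DyadicShell (Pt toReal)
open BubbleTransfer (unitVec)
open GhostTable (cellForm mixedDiffFun fwdDiffFun)
open SpinTable (bfKernel)
open SquareTable (stK)
open PlaquetteWeitzenbock (sTot sTot_sq)
open Summit.QuantumFields.BalabanUV.Beta.TameKernelCalculus (Spr Loc)
open Summit.QuantumFields.BalabanUV.Beta.D1BFx.MomentTransferPeriodic (baseKer)
open Summit.QuantumFields.BalabanUV.Beta.D1BFx.GluonLeg (Ga)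
open Summit.QuantumFields.BalabanUV.Beta.D1BFx.ReducedKernel (TableR)
open Summit.QuantumFields.BalabanUV.Beta.D1BFx.DressedTablesLeg (tadpoleTableA)
open Summit.QuantumFields.BalabanUV.Beta.D1BFx.ReducedKernelSandwich (fineHess)
open Summit.QuantumFields.BalabanUV.Beta.D1BFx.FineStencilBFBalaban (SbfBal)
open Summit.QuantumFields.BalabanUV.Beta.D1BFx.SecondStencilBF (Wbf)
open Summit.QuantumFields.BalabanUV.Beta.D1BFx.GluonKernelSectors (SbE secSt secWt)
open Summit.QuantumFields.BalabanUV.Beta.D1BFx.ModelTablesRealised (bubble_vecStn_frozen stK_of_bfKernel)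
open Summit.QuantumFields.BalabanUV.Beta.D1BFx.GhostStencil (ghCur)
open Summit.QuantumFields.BalabanUV.Beta.D1BFx.GhostCurrentRealised (bubble_ghCur_ghCur_frozen)
open Summit.QuantumFields.BalabanUV.Beta.D1BFx.GhostStencilRootedReflection (ctrHalf)
open Summit.QuantumFields.BalabanUV.Beta.D1BFx.GhostAveragingSquare (WghAt)
open Summit.QuantumFields.BalabanUV.Beta.D1BFx.GhostKernelComplete (fineHessGhQ)
open Summit.QuantumFields.BalabanUV.Beta.D1BFx.FineHessianSectors (biBubbleTable biBubbleTable_apply slotWt slotTab)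
open Summit.QuantumFields.BalabanUV.Beta.D1BFx.FineHessianLegGrades (frozenLeg frozenLeg_apply legPiece legPiece_zero Kf_gluon_eq_gradedTerms)
open Summit.QuantumFields.BalabanUV.Beta.D1BFx.FineHessianGhostGrades (ghSec ghWt ghLeg ghLeg_zero Kf_ghost_eq_gradedTerms)
open Summit.QuantumFields.BalabanUV.Beta.D1BFx.MainTable (vecK vecK_eq)
open Summit.QuantumFields.BalabanUV.Beta.D1BFx.SplitInstance (RestIdx sum_eq_add_sum_ite_ne sum4_prod)
open Summit.QuantumFields.BalabanUV.Beta.D1BFx.SectorRecut (SbT secSt' secWt' secSt'_zero secWt'_zero gradedWordSum_eq_gradedWordSum')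
open Summit.QuantumFields.BalabanUV.Beta.D1BFx.SplitRecut (restK' restK'_tad restK'_bub restK'_gtad restK'_gbub restK'_corner restK'_crossE)

/-! ## §1 The cell form is quadratic in the profile; the MAIN term with a rescaled ghost profile -/

section Main

/-- [folklore] **an3's CELL FORM IS QUADRATIC IN THE PROFILE**: `cellForm (s•g) e e′ v = s²·cellForm g e e′ v`. -/
theorem cellForm_smul {Λ : Type*} [AddCommGroup Λ] (g : Λ → ℝ) (s : ℝ) (e e' v : Λ) :
    cellForm (fun w => s * g w) e e' v = s ^ 2 * cellForm g e e' v := by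
  simp only [cellForm, mixedDiffFun, fwdDiffFun]
  ring

variable (g g' : Pt → ℝ)

/-- [folklore] **THE MAIN TERM IN CLOSED FORM, TWO PROFILES.**  `g`, `g'` even, `μ ≠ ν`, gluon frozen leg `A` (fibre `Fin 4`) of shape `δ_{ab}·g (y − x)`, ghost
frozen leg `B` (fibre `Unit`) of shape `δ_{ab}·g' (y − x)`, first vertex at the base site `u`, second at `u + (v + u_μ)`:
`ω_gl·(−½·(cE²·bubble A (vecK μ u) (vecK ν ·))) + ω_gh·(−½·(cK²·bubble B (ghCur μ u) (ghCur ν ·))) = −½·(ω_gl·cE²·(8·cellForm g − 8·D_{μν}(g²)) + ω_gh·cK²·(2·cellForm g'))`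
(`MainTable.main_table` is the case `g' = g`). -/
theorem main_tableS (hg : ∀ w, g (-w) = g w) (hg' : ∀ w, g' (-w) = g' w) {A : MKer 4 (Fin 4)} (hA : ∀ x y a b, A x y a b = if a = b then g (y - x) else 0)
    {B : MKer 4 Unit} (hB : ∀ x y a b, B x y a b = if a = b then g' (y - x) else 0) {μ ν : Fin 4} (hμν : μ ≠ ν) (ωgl ωgh cE cK : ℝ) (u v : Pt) :
    ωgl * (-(1 / 2 : ℝ) * (cE ^ 2 * bubble A (vecK μ u) (vecK ν (u + (v + unitVec μ)))))
      + ωgh * (-(1 / 2 : ℝ) * (cK ^ 2 * bubble B (ghCur μ u) (ghCur ν (u + (v + unitVec μ))))) =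
      -(1 / 2 : ℝ) * (ωgl * cE ^ 2 * (8 * cellForm g (unitVec μ) (unitVec ν) v - 8 * mixedDiffFun (fun w => g w ^ 2) (unitVec μ) (unitVec ν) v)
        + ωgh * cK ^ 2 * (2 * cellForm g' (unitVec μ) (unitVec ν) v)) := by
  rw [vecK_eq, vecK_eq, bubble_vecStn_frozen g hg hA hμν sTot u v, bubble_ghCur_ghCur_frozen g' hg' hB μ ν u v, sTot_sq]
  ring

/-- [folklore] **MAIN WITH THE GHOST PROFILE RESCALED BY `s` IS `lam·bfKernel g N` EXACTLY UNDER THE RESCALED TIE.**  If the ghost frozen leg is over `s•g`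
(`B x y a b = δ_{ab}·(s·g (y − x))`), the weights satisfy `ω_gh·(s·cK)² = −2·(ω_gl·cE²)` and `ω_gl·cE² = 2·N²·lam`, then
MAIN `= lam · bfKernel g N u_μ u_ν v` — the SAME right side as `MainTable.main_table_eq_bfKernel` (`s = 1`).  For `s = n⁻²` the tie reads `ω_gh·cK² = −2·ω_gl·cE²·n⁴`
(END-ii-SPEC (Δ1)). -/
theorem main_table_eq_bfKernelS (s : ℝ) (hg : ∀ w, g (-w) = g w) {A : MKer 4 (Fin 4)} (hA : ∀ x y a b, A x y a b = if a = b then g (y - x) else 0)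
    {B : MKer 4 Unit} (hB : ∀ x y a b, B x y a b = if a = b then s * g (y - x) else 0) {μ ν : Fin 4} (hμν : μ ≠ ν) {ωgl ωgh cE cK N lam : ℝ}
    (hωs : ωgh * (s * cK) ^ 2 = -2 * (ωgl * cE ^ 2)) (hlam : ωgl * cE ^ 2 = 2 * N ^ 2 * lam) (u v : Pt) :
    ωgl * (-(1 / 2 : ℝ) * (cE ^ 2 * bubble A (vecK μ u) (vecK ν (u + (v + unitVec μ)))))
      + ωgh * (-(1 / 2 : ℝ) * (cK ^ 2 * bubble B (ghCur μ u) (ghCur ν (u + (v + unitVec μ))))) =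
      lam * bfKernel g N (unitVec μ) (unitVec ν) v := by
  have hg' : ∀ w, (fun w => s * g w) (-w) = (fun w => s * g w) w := fun w => by simp only [hg]
  rw [main_tableS g (fun w => s * g w) hg hg' hA hB hμν, cellForm_smul, bfKernel]
  have h1 : ωgh * cK ^ 2 * (2 * (s ^ 2 * cellForm g (unitVec μ) (unitVec ν) v)) = -2 * (ωgl * cE ^ 2) * (2 * cellForm g (unitVec μ) (unitVec ν) v) := by
    rw [← hωs]
    ring
  rw [h1, hlam]
  ring

/-- [folklore] **… AND WITH THE (1.22) WEIGHT IT IS `lam·stK`**: `v_μ·v_ν·MAIN = lam·stK μ ν N g v`. -/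
theorem main_table_eq_stKS (s : ℝ) (hg : ∀ w, g (-w) = g w) {A : MKer 4 (Fin 4)} (hA : ∀ x y a b, A x y a b = if a = b then g (y - x) else 0)
    {B : MKer 4 Unit} (hB : ∀ x y a b, B x y a b = if a = b then s * g (y - x) else 0) {μ ν : Fin 4} (hμν : μ ≠ ν) {ωgl ωgh cE cK N lam : ℝ}
    (hωs : ωgh * (s * cK) ^ 2 = -2 * (ωgl * cE ^ 2)) (hlam : ωgl * cE ^ 2 = 2 * N ^ 2 * lam) (u v : Pt) :
    toReal v μ * toReal v ν *
      (ωgl * (-(1 / 2 : ℝ) * (cE ^ 2 * bubble A (vecK μ u) (vecK ν (u + (v + unitVec μ)))))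
        + ωgh * (-(1 / 2 : ℝ) * (cK ^ 2 * bubble B (ghCur μ u) (ghCur ν (u + (v + unitVec μ)))))) =
      lam * stK μ ν N g v := by
  rw [main_table_eq_bfKernelS g s hg hA hB hμν hωs hlam, stK_of_bfKernel]
  ring

end Main

/-! ## §2 The re-cut REST word table with the ghost words at a second profile -/

section Words

/-- [our object] **THE RE-CUT REST WORD INTEGRANDS, TWO PROFILES** at the base site `b`, displacement `w`: `SplitRecut.restK'` at the profile `g` on the
gluon tadpole words, the re-cut gluon bubble words, the corner word and the re-cut E-sector cross word, and at the profile `g'` on the ghost tadpole and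
ghost bubble words (`ghLeg n a g' = ![frozenLeg g', Ggh n a − frozenLeg g']`).  A DEFINITION; asserts nothing.  `restKS … g g … = restK' … g …` (`restKS_self`). -/
noncomputable def restKS (n : ℕ) [NeZero n] (a : ℝ) (g g' : Pt → ℝ) (cE cΛ cR cK cQ cE₂ cJ4 cΛ₂ cR₂ cQ₂ x₀ : ℝ) (WE WJ WΛ WR WQ : TableR)
    (ωgl ωgh lam N : ℝ) (μ ν : Fin 4) (b : Pt) : RestIdx → Pt → ℝ
  | Sum.inl x => restK' n a g cE cΛ cR cK cQ cE₂ cJ4 cΛ₂ cR₂ cQ₂ x₀ WE WJ WΛ WR WQ ωgl ωgh lam N μ ν b (Sum.inl x)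
  | Sum.inr (Sum.inl x) => restK' n a g cE cΛ cR cK cQ cE₂ cJ4 cΛ₂ cR₂ cQ₂ x₀ WE WJ WΛ WR WQ ωgl ωgh lam N μ ν b (Sum.inr (Sum.inl x))
  | Sum.inr (Sum.inr (Sum.inl r)) => restK' n a g' cE cΛ cR cK cQ cE₂ cJ4 cΛ₂ cR₂ cQ₂ x₀ WE WJ WΛ WR WQ ωgl ωgh lam N μ ν b (Sum.inr (Sum.inr (Sum.inl r)))
  | Sum.inr (Sum.inr (Sum.inr (Sum.inl x))) =>
      restK' n a g' cE cΛ cR cK cQ cE₂ cJ4 cΛ₂ cR₂ cQ₂ x₀ WE WJ WΛ WR WQ ωgl ωgh lam N μ ν b (Sum.inr (Sum.inr (Sum.inr (Sum.inl x))))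
  | Sum.inr (Sum.inr (Sum.inr (Sum.inr k))) => restK' n a g cE cΛ cR cK cQ cE₂ cJ4 cΛ₂ cR₂ cQ₂ x₀ WE WJ WΛ WR WQ ωgl ωgh lam N μ ν b (Sum.inr (Sum.inr (Sum.inr (Sum.inr k))))

variable (n : ℕ) [NeZero n] (a : ℝ) (g g' : Pt → ℝ) (cE cΛ cR cK cQ cE₂ cJ4 cΛ₂ cR₂ cQ₂ x₀ : ℝ) (WE WJ WΛ WR WQ : TableR)
  (ωgl ωgh lam N : ℝ) (μ ν : Fin 4) (b : Pt)

/-- [our object] Unfolding: gluon tadpole words (profile `g`). -/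
theorem restKS_tad (x : Fin 5 × Fin 3) (w : Pt) :
    restKS n a g g' cE cΛ cR cK cQ cE₂ cJ4 cΛ₂ cR₂ cQ₂ x₀ WE WJ WΛ WR WQ ωgl ωgh lam N μ ν b (Sum.inl x) w =
      ωgl * (slotWt cE₂ cJ4 cΛ₂ cR₂ cQ₂ x.1 *
        (((n : ℝ) ^ 8)⁻¹ * (toReal w μ * toReal w ν * baseKer (tadpoleTableA (legPiece n a g x.2) (slotTab WE WJ WΛ WR WQ x.1) μ ν) b w))) := rfl

/-- [our object] Unfolding: the re-cut gluon bubble words (profile `g`; the `0000` word replaced by `0`). -/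
theorem restKS_bub (x : Fin 3 × Fin 3 × Fin 3 × Fin 3) (w : Pt) :
    restKS n a g g' cE cΛ cR cK cQ cE₂ cJ4 cΛ₂ cR₂ cQ₂ x₀ WE WJ WΛ WR WQ ωgl ωgh lam N μ ν b (Sum.inr (Sum.inl x)) w =
      ωgl * (if x = ((0 : Fin 3), (0 : Fin 3), (0 : Fin 3), (0 : Fin 3)) then 0 else
        secWt' cE cΛ x.1 * secWt' cE cΛ x.2.1 *
          (((n : ℝ) ^ 8)⁻¹ * (toReal w μ * toReal w ν *
            baseKer (biBubbleTable (legPiece n a g x.2.2.1) (legPiece n a g x.2.2.2) (secSt' n a cE cR cK cQ x.1) (secSt' n a cE cR cK cQ x.2.1) μ ν)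
              b w))) := rfl

/-- [our object] Unfolding: ghost tadpole words (profile `g'`). -/
theorem restKS_gtad (r : Fin 2) (w : Pt) :
    restKS n a g g' cE cΛ cR cK cQ cE₂ cJ4 cΛ₂ cR₂ cQ₂ x₀ WE WJ WΛ WR WQ ωgl ωgh lam N μ ν b (Sum.inr (Sum.inr (Sum.inl r))) w =
      ωgh * (((n : ℝ) ^ 8)⁻¹ * (toReal w μ * toReal w ν * baseKer (tadpoleTableA (ghLeg n a g' r) (WghAt (ctrHalf n) n x₀ cK cQ) μ ν) b w)) := rfl

/-- [our object] Unfolding: ghost bubble words (profile `g'`; the `0000` word replaced by `0`). -/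
theorem restKS_gbub (x : Fin 2 × Fin 2 × Fin 2 × Fin 2) (w : Pt) :
    restKS n a g g' cE cΛ cR cK cQ cE₂ cJ4 cΛ₂ cR₂ cQ₂ x₀ WE WJ WΛ WR WQ ωgl ωgh lam N μ ν b (Sum.inr (Sum.inr (Sum.inr (Sum.inl x)))) w =
      ωgh * (if x = ((0 : Fin 2), (0 : Fin 2), (0 : Fin 2), (0 : Fin 2)) then 0 else
        ghWt cK cQ x.1 * ghWt cK cQ x.2.1 *
          (((n : ℝ) ^ 8)⁻¹ * (toReal w μ * toReal w ν *
            baseKer (biBubbleTable (ghLeg n a g' x.2.2.1) (ghLeg n a g' x.2.2.2) (ghSec n x.1) (ghSec n x.2.1) μ ν) b w))) := rfl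

/-- [our object] Unfolding: the corner word (profile `g`). -/
theorem restKS_corner (w : Pt) :
    restKS n a g g' cE cΛ cR cK cQ cE₂ cJ4 cΛ₂ cR₂ cQ₂ x₀ WE WJ WΛ WR WQ ωgl ωgh lam N μ ν b (Sum.inr (Sum.inr (Sum.inr (Sum.inr 0)))) w =
      ((n : ℝ) ^ 8)⁻¹ * (toReal w μ * toReal w ν * (lam * bfKernel g N (unitVec μ) (unitVec ν) (-w - unitVec μ))) - stK μ ν N g w := rfl

/-- [our object] Unfolding: the re-cut E-sector cross word (profile `g`). -/
theorem restKS_crossE (w : Pt) :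
    restKS n a g g' cE cΛ cR cK cQ cE₂ cJ4 cΛ₂ cR₂ cQ₂ x₀ WE WJ WΛ WR WQ ωgl ωgh lam N μ ν b (Sum.inr (Sum.inr (Sum.inr (Sum.inr 1)))) w =
      ωgl * (cE * cE * (((n : ℝ) ^ 8)⁻¹ * (toReal w μ * toReal w ν *
        (-(1 / 2 : ℝ) * (bubble (frozenLeg g : MKer 4 (Fin 4)) (SbT μ (b + w)) (SbT ν b)
          - bubble (frozenLeg g : MKer 4 (Fin 4)) (vecK μ (b + w)) (vecK ν b)))))) := rfl

/-- [our object] On the gluon tadpole words `restKS g g'` IS `restK'` at `g` (definitionally). -/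
theorem restKS_tad_eq (x : Fin 5 × Fin 3) :
    restKS n a g g' cE cΛ cR cK cQ cE₂ cJ4 cΛ₂ cR₂ cQ₂ x₀ WE WJ WΛ WR WQ ωgl ωgh lam N μ ν b (Sum.inl x) =
      restK' n a g cE cΛ cR cK cQ cE₂ cJ4 cΛ₂ cR₂ cQ₂ x₀ WE WJ WΛ WR WQ ωgl ωgh lam N μ ν b (Sum.inl x) := rfl

/-- [our object] … on the re-cut gluon bubble words: `restK'` at `g`. -/
theorem restKS_bub_eq (x : Fin 3 × Fin 3 × Fin 3 × Fin 3) :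
    restKS n a g g' cE cΛ cR cK cQ cE₂ cJ4 cΛ₂ cR₂ cQ₂ x₀ WE WJ WΛ WR WQ ωgl ωgh lam N μ ν b (Sum.inr (Sum.inl x)) =
      restK' n a g cE cΛ cR cK cQ cE₂ cJ4 cΛ₂ cR₂ cQ₂ x₀ WE WJ WΛ WR WQ ωgl ωgh lam N μ ν b (Sum.inr (Sum.inl x)) := rfl

/-- [our object] … on the ghost tadpole words: `restK'` at the SECOND profile `g'`. -/
theorem restKS_gtad_eq (r : Fin 2) :
    restKS n a g g' cE cΛ cR cK cQ cE₂ cJ4 cΛ₂ cR₂ cQ₂ x₀ WE WJ WΛ WR WQ ωgl ωgh lam N μ ν b (Sum.inr (Sum.inr (Sum.inl r))) =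
      restK' n a g' cE cΛ cR cK cQ cE₂ cJ4 cΛ₂ cR₂ cQ₂ x₀ WE WJ WΛ WR WQ ωgl ωgh lam N μ ν b (Sum.inr (Sum.inr (Sum.inl r))) := rfl

/-- [our object] … on the ghost bubble words: `restK'` at the SECOND profile `g'`. -/
theorem restKS_gbub_eq (x : Fin 2 × Fin 2 × Fin 2 × Fin 2) :
    restKS n a g g' cE cΛ cR cK cQ cE₂ cJ4 cΛ₂ cR₂ cQ₂ x₀ WE WJ WΛ WR WQ ωgl ωgh lam N μ ν b (Sum.inr (Sum.inr (Sum.inr (Sum.inl x)))) =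
      restK' n a g' cE cΛ cR cK cQ cE₂ cJ4 cΛ₂ cR₂ cQ₂ x₀ WE WJ WΛ WR WQ ωgl ωgh lam N μ ν b (Sum.inr (Sum.inr (Sum.inr (Sum.inl x)))) := rfl

/-- [our object] … on the corner word: `restK'` at `g`. -/
theorem restKS_corner_eq :
    restKS n a g g' cE cΛ cR cK cQ cE₂ cJ4 cΛ₂ cR₂ cQ₂ x₀ WE WJ WΛ WR WQ ωgl ωgh lam N μ ν b (Sum.inr (Sum.inr (Sum.inr (Sum.inr 0)))) =
      restK' n a g cE cΛ cR cK cQ cE₂ cJ4 cΛ₂ cR₂ cQ₂ x₀ WE WJ WΛ WR WQ ωgl ωgh lam N μ ν b (Sum.inr (Sum.inr (Sum.inr (Sum.inr 0)))) := rfl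

/-- [our object] … on the re-cut E-sector cross word: `restK'` at `g`. -/
theorem restKS_crossE_eq :
    restKS n a g g' cE cΛ cR cK cQ cE₂ cJ4 cΛ₂ cR₂ cQ₂ x₀ WE WJ WΛ WR WQ ωgl ωgh lam N μ ν b (Sum.inr (Sum.inr (Sum.inr (Sum.inr 1)))) =
      restK' n a g cE cΛ cR cK cQ cE₂ cJ4 cΛ₂ cR₂ cQ₂ x₀ WE WJ WΛ WR WQ ωgl ωgh lam N μ ν b (Sum.inr (Sum.inr (Sum.inr (Sum.inr 1)))) := rfl

/-- [our object] **EQUAL PROFILES GIVE THE TABLE OF RECORD**: `restKS … g g … = restK' … g …`. -/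
theorem restKS_self :
    restKS n a g g cE cΛ cR cK cQ cE₂ cJ4 cΛ₂ cR₂ cQ₂ x₀ WE WJ WΛ WR WQ ωgl ωgh lam N μ ν b =
      restK' n a g cE cΛ cR cK cQ cE₂ cJ4 cΛ₂ cR₂ cQ₂ x₀ WE WJ WΛ WR WQ ωgl ωgh lam N μ ν b := by
  funext τ
  rcases τ with x | x | r | x | k <;> rfl

/-- [folklore] **THE SUM OVER THE REST INDEX OF THE TWO-PROFILE TABLE AS SIX EXPLICIT PIECES.** -/
theorem sum_restKS (w : Pt) :
    ∑ τ : RestIdx, restKS n a g g' cE cΛ cR cK cQ cE₂ cJ4 cΛ₂ cR₂ cQ₂ x₀ WE WJ WΛ WR WQ ωgl ωgh lam N μ ν b τ w =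
      ωgl * (∑ x : Fin 5 × Fin 3, slotWt cE₂ cJ4 cΛ₂ cR₂ cQ₂ x.1 *
        (((n : ℝ) ^ 8)⁻¹ * (toReal w μ * toReal w ν * baseKer (tadpoleTableA (legPiece n a g x.2) (slotTab WE WJ WΛ WR WQ x.1) μ ν) b w)))
      + ωgl * (∑ x : Fin 3 × Fin 3 × Fin 3 × Fin 3, if x = ((0 : Fin 3), (0 : Fin 3), (0 : Fin 3), (0 : Fin 3)) then 0 else
          secWt' cE cΛ x.1 * secWt' cE cΛ x.2.1 *
            (((n : ℝ) ^ 8)⁻¹ * (toReal w μ * toReal w ν *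
              baseKer (biBubbleTable (legPiece n a g x.2.2.1) (legPiece n a g x.2.2.2) (secSt' n a cE cR cK cQ x.1) (secSt' n a cE cR cK cQ x.2.1)
                μ ν) b w)))
      + ωgh * (∑ r : Fin 2, ((n : ℝ) ^ 8)⁻¹ * (toReal w μ * toReal w ν * baseKer (tadpoleTableA (ghLeg n a g' r) (WghAt (ctrHalf n) n x₀ cK cQ) μ ν) b w))
      + ωgh * (∑ x : Fin 2 × Fin 2 × Fin 2 × Fin 2, if x = ((0 : Fin 2), (0 : Fin 2), (0 : Fin 2), (0 : Fin 2)) then 0 else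
          ghWt cK cQ x.1 * ghWt cK cQ x.2.1 *
            (((n : ℝ) ^ 8)⁻¹ * (toReal w μ * toReal w ν *
              baseKer (biBubbleTable (ghLeg n a g' x.2.2.1) (ghLeg n a g' x.2.2.2) (ghSec n x.1) (ghSec n x.2.1) μ ν) b w)))
      + ((((n : ℝ) ^ 8)⁻¹ * (toReal w μ * toReal w ν * (lam * bfKernel g N (unitVec μ) (unitVec ν) (-w - unitVec μ))) - stK μ ν N g w)
        + ωgl * (cE * cE * (((n : ℝ) ^ 8)⁻¹ * (toReal w μ * toReal w ν *
          (-(1 / 2 : ℝ) * (bubble (frozenLeg g : MKer 4 (Fin 4)) (SbT μ (b + w)) (SbT ν b)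
            - bubble (frozenLeg g : MKer 4 (Fin 4)) (vecK μ (b + w)) (vecK ν b))))))) := by
  rw [Fintype.sum_sum_type, Fintype.sum_sum_type, Fintype.sum_sum_type, Fintype.sum_sum_type]
  have hk : ∑ k : Fin 2, restKS n a g g' cE cΛ cR cK cQ cE₂ cJ4 cΛ₂ cR₂ cQ₂ x₀ WE WJ WΛ WR WQ ωgl ωgh lam N μ ν b (Sum.inr (Sum.inr (Sum.inr (Sum.inr k)))) w
      = restKS n a g g' cE cΛ cR cK cQ cE₂ cJ4 cΛ₂ cR₂ cQ₂ x₀ WE WJ WΛ WR WQ ωgl ωgh lam N μ ν b (Sum.inr (Sum.inr (Sum.inr (Sum.inr 0)))) w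
        + restKS n a g g' cE cΛ cR cK cQ cE₂ cJ4 cΛ₂ cR₂ cQ₂ x₀ WE WJ WΛ WR WQ ωgl ωgh lam N μ ν b (Sum.inr (Sum.inr (Sum.inr (Sum.inr 1)))) w :=
    Fin.sum_univ_two _
  rw [hk, restKS_corner, restKS_crossE]
  simp only [restKS_tad, restKS_bub, restKS_gtad, restKS_gbub, ← Finset.mul_sum]
  ring

end Words

/-! ## §3 The (SPLIT) identity at a base site, ghost words at the rescaled profile -/

section Split

variable (n : ℕ) [NeZero n] (a : ℝ) {g : Pt → ℝ} (cE cVH cΛ cR cK cQ cE₂ cJ4 cΛ₂ cR₂ cQ₂ x₀ : ℝ) (WE WJ WΛ WR WQ : TableR)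
  {ωgl ωgh lam N : ℝ} {μ ν : Fin 4}

/-- [folklore] **THE (SPLIT) IDENTITY AT A BASE SITE, VARIANT «ENDₛ»** — `SplitRecut.split_at_basePoint_recut` with the loop-weight tie RESCALED,
`hωs : ω_gh·(s·cK)² = −2·(ω_gl·cE²)`, and the ghost graded words read at the profile `s•g` (`restKS g (fun v => s * g v)`); every other hypothesis
(`0 < a`, `Spr (Ga n a)`, `g` exponentially bounded and even, `Loc` of the five slot tables, `μ ≠ ν`, normalisation `hlam`) and the LEFT side are
byte-identical to the identity of record: for every displacement `w`,
`ω_gl·[n⁻⁸·w_μw_ν·baseKer (fineHess n a SbfBal Wbf μ ν) b w] + ω_gh·[n⁻⁸·w_μw_ν·baseKer (fineHessGhQ n a x₀ cK cQ μ ν) b w] = stK μ ν N g w + Σ_{τ : RestIdx} restKS … g (s•g) … τ w`.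
`s = 1`: the identity of record (`restKS_self`); `s = n⁻²`: END-ii. -/
theorem split_at_basePoint_recutS (ha : 0 < a) (hGa : Spr (Ga n a)) {C δ : ℝ} (hδ : 0 < δ) (hg : ∀ v, |g v| ≤ C * Real.exp (-δ * l1 v))
    (hgev : ∀ w, g (-w) = g w) (hE : ∀ κ u l u', Loc (WE κ u l u')) (hJ : ∀ κ u l u', Loc (WJ κ u l u'))
    (hΛ : ∀ κ u l u', Loc (WΛ κ u l u')) (hR : ∀ κ u l u', Loc (WR κ u l u')) (hQ : ∀ κ u l u', Loc (WQ κ u l u'))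
    (hμν : μ ≠ ν) (s : ℝ) (hωs : ωgh * (s * cK) ^ 2 = -2 * (ωgl * cE ^ 2)) (hlam : ωgl * cE ^ 2 = 2 * N ^ 2 * lam) (b w : Pt) :
    ωgl * (((n : ℝ) ^ 8)⁻¹ * (toReal w μ * toReal w ν *
        baseKer (fineHess n a (SbfBal n a cE cVH cΛ cR cK cQ) (Wbf cE₂ cJ4 cΛ₂ cR₂ cQ₂ WE WJ WΛ WR WQ) μ ν) b w))
      + ωgh * (((n : ℝ) ^ 8)⁻¹ * (toReal w μ * toReal w ν * baseKer (fineHessGhQ n a x₀ cK cQ μ ν) b w)) =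
      stK μ ν N g w
        + ∑ τ : RestIdx, restKS n a g (fun v => s * g v) cE cΛ cR cK cQ cE₂ cJ4 cΛ₂ cR₂ cQ₂ x₀ WE WJ WΛ WR WQ ωgl ωgh lam N μ ν b τ w := by
  -- the rescaled profile is exponentially bounded
  have hg' : ∀ v, |s * g v| ≤ |s| * C * Real.exp (-δ * l1 v) := fun v => by
    rw [abs_mul, mul_assoc]
    exact mul_le_mul_of_nonneg_left (hg v) (abs_nonneg s)
  -- the two graded expansions (A0-FINE; the ghost one AT THE PROFILE `s•g`) and the REST sum in pieces
  rw [Kf_gluon_eq_gradedTerms n a cE cVH cΛ cR cK cQ cE₂ cJ4 cΛ₂ cR₂ cQ₂ WE WJ WΛ WR WQ ha hGa hδ hg hE hJ hΛ hR hQ μ ν b w,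
    Kf_ghost_eq_gradedTerms n a cK cQ x₀ ha hδ hg' μ ν b w, sum_restKS]
  -- nested sums as sums over products; the 81 gluon bubble words re-cut; isolate the two `0000` bubble words
  rw [Fintype.sum_prod_type' (fun s r => slotWt cE₂ cJ4 cΛ₂ cR₂ cQ₂ s * (((n : ℝ) ^ 8)⁻¹ * (toReal w μ * toReal w ν *
      baseKer (tadpoleTableA (legPiece n a g r) (slotTab WE WJ WΛ WR WQ s) μ ν) b w)))]
  rw [sum4_prod (fun i j r r' => secWt cE cΛ cR i * secWt cE cΛ cR j * (((n : ℝ) ^ 8)⁻¹ * (toReal w μ * toReal w ν *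
      baseKer (biBubbleTable (legPiece n a g r) (legPiece n a g r') (secSt n a cK cQ i) (secSt n a cK cQ j) μ ν) b w))),
    sum4_prod (fun i j r r' => ghWt cK cQ i * ghWt cK cQ j * (((n : ℝ) ^ 8)⁻¹ * (toReal w μ * toReal w ν *
      baseKer (biBubbleTable (ghLeg n a (fun v => s * g v) r) (ghLeg n a (fun v => s * g v) r') (ghSec n i) (ghSec n j) μ ν) b w))),
    gradedWordSum_eq_gradedWordSum' n a cE cΛ cR cK cQ ha hGa hδ hg μ ν b w,
    sum_eq_add_sum_ite_ne (fun x : Fin 3 × Fin 3 × Fin 3 × Fin 3 => secWt' cE cΛ x.1 * secWt' cE cΛ x.2.1 * (((n : ℝ) ^ 8)⁻¹ *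
      (toReal w μ * toReal w ν * baseKer (biBubbleTable (legPiece n a g x.2.2.1) (legPiece n a g x.2.2.2) (secSt' n a cE cR cK cQ x.1)
        (secSt' n a cE cR cK cQ x.2.1) μ ν) b w))) ((0 : Fin 3), (0 : Fin 3), (0 : Fin 3), (0 : Fin 3)),
    sum_eq_add_sum_ite_ne (fun x : Fin 2 × Fin 2 × Fin 2 × Fin 2 => ghWt cK cQ x.1 * ghWt cK cQ x.2.1 * (((n : ℝ) ^ 8)⁻¹ *
      (toReal w μ * toReal w ν * baseKer (biBubbleTable (ghLeg n a (fun v => s * g v) x.2.2.1) (ghLeg n a (fun v => s * g v) x.2.2.2)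
        (ghSec n x.1) (ghSec n x.2.1) μ ν) b w))) ((0 : Fin 2), (0 : Fin 2), (0 : Fin 2), (0 : Fin 2))]
  -- the model block of the gluon `0000` word plus the ghost `0000` word over `s•g` is `lam·bfKernel g` at an3's corner
  have hposv : vecK ν b = vecK ν ((b + w) + ((-w - unitVec μ) + unitVec μ)) := by congr 1; abel
  have hposg : ghCur ν b = ghCur ν ((b + w) + ((-w - unitVec μ) + unitVec μ)) := by congr 1; abel
  have hmain : ωgl * (-(1 / 2 : ℝ) * (cE ^ 2 * bubble (frozenLeg g : MKer 4 (Fin 4)) (vecK μ (b + w)) (vecK ν b)))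
      + ωgh * (-(1 / 2 : ℝ) * (cK ^ 2 * bubble (frozenLeg (fun v => s * g v) : MKer 4 Unit) (ghCur μ (b + w)) (ghCur ν b))) =
      lam * bfKernel g N (unitVec μ) (unitVec ν) (-w - unitVec μ) := by
    rw [hposv, hposg]
    exact main_table_eq_bfKernelS g s hgev (fun x y a' b' => frozenLeg_apply g x y a' b')
      (fun x y a' b' => frozenLeg_apply (fun v => s * g v) x y a' b') hμν hωs hlam (b + w) (-w - unitVec μ)
  -- the two isolated words in explicit form
  have e1 : secWt' cE cΛ 0 * secWt' cE cΛ 0 * (((n : ℝ) ^ 8)⁻¹ * (toReal w μ * toReal w ν *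
      baseKer (biBubbleTable (legPiece n a g 0) (legPiece n a g 0) (secSt' n a cE cR cK cQ 0) (secSt' n a cE cR cK cQ 0) μ ν) b w)) =
      cE * cE * (((n : ℝ) ^ 8)⁻¹ * (toReal w μ * toReal w ν * (-(1 / 2 : ℝ) * bubble (frozenLeg g : MKer 4 (Fin 4)) (SbT μ (b + w)) (SbT ν b)))) := by
    rw [secWt'_zero, secSt'_zero, legPiece_zero, baseKer, biBubbleTable_apply]
    rfl
  have e2 : ghWt cK cQ 0 * ghWt cK cQ 0 * (((n : ℝ) ^ 8)⁻¹ * (toReal w μ * toReal w ν *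
      baseKer (biBubbleTable (ghLeg n a (fun v => s * g v) 0) (ghLeg n a (fun v => s * g v) 0) (ghSec n 0) (ghSec n 0) μ ν) b w)) =
      cK * cK * (((n : ℝ) ^ 8)⁻¹ * (toReal w μ * toReal w ν *
        (-(1 / 2 : ℝ) * bubble (frozenLeg (fun v => s * g v) : MKer 4 Unit) (ghCur μ (b + w)) (ghCur ν b)))) := by
    rw [ghLeg_zero, baseKer, biBubbleTable_apply]
    rfl
  simp only [e1, e2]
  linear_combination (((n : ℝ) ^ 8)⁻¹ * (toReal w μ * toReal w ν)) * hmain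

/-- [folklore] **`s = 1` IS THE IDENTITY OF RECORD** (sanity instance): under the tie of record `hω : ω_gh·cK² = −2·(ω_gl·cE²)` the «ENDₛ» identity at `s = 1`
rewrites to `SplitRecut.split_at_basePoint_recut`'s right side `stK μ ν N g w + Σ_τ restK' … g … τ w`. -/
theorem split_at_basePoint_recutS_one (ha : 0 < a) (hGa : Spr (Ga n a)) {C δ : ℝ} (hδ : 0 < δ) (hg : ∀ v, |g v| ≤ C * Real.exp (-δ * l1 v))
    (hgev : ∀ w, g (-w) = g w) (hE : ∀ κ u l u', Loc (WE κ u l u')) (hJ : ∀ κ u l u', Loc (WJ κ u l u'))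
    (hΛ : ∀ κ u l u', Loc (WΛ κ u l u')) (hR : ∀ κ u l u', Loc (WR κ u l u')) (hQ : ∀ κ u l u', Loc (WQ κ u l u'))
    (hμν : μ ≠ ν) (hω : ωgh * cK ^ 2 = -2 * (ωgl * cE ^ 2)) (hlam : ωgl * cE ^ 2 = 2 * N ^ 2 * lam) (b w : Pt) :
    ωgl * (((n : ℝ) ^ 8)⁻¹ * (toReal w μ * toReal w ν *
        baseKer (fineHess n a (SbfBal n a cE cVH cΛ cR cK cQ) (Wbf cE₂ cJ4 cΛ₂ cR₂ cQ₂ WE WJ WΛ WR WQ) μ ν) b w))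
      + ωgh * (((n : ℝ) ^ 8)⁻¹ * (toReal w μ * toReal w ν * baseKer (fineHessGhQ n a x₀ cK cQ μ ν) b w)) =
      stK μ ν N g w + ∑ τ : RestIdx, restK' n a g cE cΛ cR cK cQ cE₂ cJ4 cΛ₂ cR₂ cQ₂ x₀ WE WJ WΛ WR WQ ωgl ωgh lam N μ ν b τ w := by
  have hωs : ωgh * ((1 : ℝ) * cK) ^ 2 = -2 * (ωgl * cE ^ 2) := by rw [one_mul]; exact hω
  have h := split_at_basePoint_recutS n a cE cVH cΛ cR cK cQ cE₂ cJ4 cΛ₂ cR₂ cQ₂ x₀ WE WJ WΛ WR WQ ha hGa hδ hg hgev hE hJ hΛ hR hQ hμν 1 hωs hlam b w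
  have hone : (fun v => (1 : ℝ) * g v) = g := funext fun v => one_mul _
  rw [hone, restKS_self] at h
  exact h

end Split

end Summit.QuantumFields.BalabanUV.Beta.D1BFx.SplitInstanceS

end
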